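import Summits.ResolutionOfSingularities.ResolutionOfSingularities.Theorems.EquisingularLiftEquisingularLiftNatConormalFrameOfGenerators
import Literature.AlgebraicGeometry.Resolution.QuasiRegularSequences
import HarnessLib

/-!
# [OURS · L1 W4.5(b) · EL♮(3) · S6 (L) C2, sub-brick B1′⁺] Conormal frames from a QUASI-REGULAR generating sequence
Crux chain w45b, child EL♮(3) = stmt-ResolutionOfSingularities-20148; C2 sub-brick B1′⁺ (res-type-027 g15, 2026-08-28T00:03:24Z (5)):
frame the conormal sheaf on B1′'s adapted chart `(W, c)` (`exists_affine_adaptedFrame`, p586914) whose `c` is QUASI-REGULAR in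
`Γ(G₀, W)`. The engine `exists_conormalFrame_of_generators` (p586543) asks for `IsWeaklyRegular`, but its proof
(Literature `HodgeTheory.nonempty_basis_sections_pullback_idealModule`) uses it only through LECH INDEPENDENCE
`Σ c_j x_j = 0 ⇒ c_j ∈ (x)` = quasi-regularity in degree one (`IsQuasiRegular.lech`); «quasi-regular ⇒ regular» (Matsumura 16.5) is
not in the tree. Twins with the Literature proof bodies VERBATIM (one hypothesis swapped; the two private helpers copied):
`nonempty_basis_sections_pullback_idealModule_of_lech`, `exists_basis_sections_pullback_idealModule_eq_of_lech`,
**`exists_conormalFrame_of_generators_of_isQuasiRegular`**. Written by res-L1-w45b-stub-3 g7 on the tree's Literature proofs; OURS;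
NOT a statement of any manuscript; AI-written, weaker than expert review. No `sorry`; standard axioms; DEF-FREE.
`--supports stmt-ResolutionOfSingularities-20148 --as helper`. [cite: GortzWedhorn2023, Rem. 19.22] [cite: Matsumura1987, §16] (index only).
-/

set_option linter.dupNamespace false -- mandated namespace `Summit.<Summit>.<Problem>` of this single-conjunct summit

noncomputable section

open CategoryTheory CategoryTheory.Limits AlgebraicGeometry Opposite TopologicalSpace
open Literature.AlgebraicGeometry.Modules Literature.AlgebraicGeometry.Morphisms
open Literature.AlgebraicGeometry.Deformation Literature.AlgebraicGeometry.Motives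
open Literature.AlgebraicGeometry.HodgeTheory Literature.AlgebraicGeometry.Resolution

namespace Summit.ResolutionOfSingularities.ResolutionOfSingularities.Cruxes.EquisingularLiftNat.Sections

open Summit.ResolutionOfSingularities.ResolutionOfSingularities.Cruxes.EquisingularLiftNat.P1VB

universe u

/-- Transport of submodule membership along an equality of elements (copy of the Literature file's private helper). [folklore] -/
theorem memSubmodule_of_eq_of_mem {R M : Type*} [Semiring R] [AddCommMonoid M] [Module R M]
    {S : Submodule R M} {a b : M} (h : a = b) (hb : b ∈ S) : a ∈ S := h ▸ hb

open scoped ChangeOfRings in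
/-- **For `φ : A → B` surjective with kernel `K` and an `A`-module `P`: if `1 ⊗ p = 0` in `B ⊗_A P` then `p ∈ K·P`** (copy of the
Literature file's private helper `mem_ker_smul_top_of_one_tmul_eq_zero`). [cite: AtiyahMacdonald1969, Ch. 2, Exercise 2] -/
theorem mem_ker_smul_top_of_one_tmul_eq_zero_copy {A B : Type u} [CommRing A] [CommRing B] (φ : A →+* B)
    (hφ : Function.Surjective φ) (P : ModuleCat.{u} A) (p : P)
    (h : ((1 : B) ⊗ₜ[A, φ] p : (ModuleCat.extendScalars φ).obj P) = 0) :
    p ∈ RingHom.ker φ • (⊤ : Submodule A P) := by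
  letI : Module A B := Module.compHom B φ
  set K : Ideal A := RingHom.ker φ with hK
  let e₀ : (A ⧸ K) ≃+* B := RingHom.quotientKerEquivOfSurjective hφ
  let e : (A ⧸ K) ≃ₗ[A] B :=
    { e₀.toAddEquiv with
      map_smul' := fun a q => by
        obtain ⟨r, rfl⟩ := Ideal.Quotient.mk_surjective q
        change e₀ (a • Ideal.Quotient.mk K r) = φ a * e₀ (Ideal.Quotient.mk K r)
        rw [Algebra.smul_def, Ideal.Quotient.algebraMap_eq, map_mul,
          RingHom.quotientKerEquivOfSurjective_apply_mk] }
  have he1 : e.symm (1 : B) = 1 := by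
    apply e.injective
    rw [LinearEquiv.apply_symm_apply]
    exact (map_one e₀).symm
  have h2 : TensorProduct.congr e.symm (LinearEquiv.refl A P) ((1 : B) ⊗ₜ[A] p) =
      (1 : A ⧸ K) ⊗ₜ[A] p := by
    rw [TensorProduct.congr_tmul, he1]
    rfl
  have h3 := TensorProduct.quotTensorEquivQuotSMul_mk_one_tmul (M := P) K p
  have h' : ((1 : B) ⊗ₜ[A] p : TensorProduct A B P) = 0 := h
  have h0 : (Submodule.Quotient.mk p : P ⧸ K • (⊤ : Submodule A P)) = 0 := by
    rw [← h3, ← h2, h', map_zero, map_zero]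
  exact (Submodule.Quotient.mk_eq_zero _).1 h0

open MvPolynomial in
/-- **Quasi-regularity in degree one is Lech independence**: if `x` is quasi-regular and `Σ_j c_j x_j = 0`, then every `c_j`
lies in `(x)` (the linear form `Σ c_j X_j` vanishes at `x`). [cite: Matsumura1987, §16 Definition p. 124] -/
theorem IsQuasiRegular.lech {R : Type u} [CommRing R] {n : ℕ} {x : Fin n → R} (hx : IsQuasiRegular x)
    (c : Fin n → R) (hc : ∑ j, c j * x j = 0) (j : Fin n) : c j ∈ Ideal.span (Set.range x) := by
  classical
  have hF : (∑ j', C (c j') * X j' : MvPolynomial (Fin n) R).IsHomogeneous 1 := by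
    refine IsHomogeneous.sum _ _ _ fun j' _ => ?_
    simpa using (isHomogeneous_C (Fin n) (c j')).mul (isHomogeneous_X R j')
  have hev : eval x (∑ j', C (c j') * X j' : MvPolynomial (Fin n) R) ∈ Ideal.span (Set.range x) ^ (1 + 1) := by
    have h0 : eval x (∑ j', C (c j') * X j' : MvPolynomial (Fin n) R) = 0 := by simpa using hc
    rw [h0]
    exact Ideal.zero_mem _
  have h := (isQuasiRegular_def x).mp hx 1 _ hF hev (Finsupp.single j 1)
  have hcoeff : coeff (Finsupp.single j 1) (∑ j', C (c j') * X j' : MvPolynomial (Fin n) R) = c j := by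
    rw [coeff_sum]
    simp_rw [coeff_C_mul, coeff_X]
    simp only [Finsupp.single_left_inj one_ne_zero, mul_ite, mul_one, mul_zero]
    rw [Finset.sum_ite_eq']
    simp
  rwa [hcoeff] at h

set_option maxRecDepth 4000 in
open scoped ChangeOfRings in
/-- **Lech-independence twin of `HodgeTheory.nonempty_basis_sections_pullback_idealModule`**: the same conclusion with the
weakly-regular hypothesis replaced by the only consequence its proof uses, Lech independence of `x`
(`Σ c_j x_j = 0 ⇒ c_j ∈ (x)`, i.e. quasi-regularity in degree one). Proof body verbatim from the Literature file.
[cite: GortzWedhorn2023, Rem. 19.22] [cite: Matsumura1987, §16, Thm. 16.2 (i)] -/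
theorem nonempty_basis_sections_pullback_idealModule_of_lech {X Z : Scheme.{u}} (i : Z ⟶ X)
    [IsLocallyNoetherian X] [IsClosedImmersion i]
    (V : X.affineOpens) {n : ℕ} (x : Fin n → Γ(X, (V : X.Opens)))
    (hlech : ∀ c : Fin n → Γ(X, (V : X.Opens)), ∑ j, c j * x j = 0 → ∀ j, c j ∈ Ideal.span (Set.range x))
    (hI : Ideal.span (Set.range x) = i.ker.ideal V) :
    Nonempty (Module.Basis (Fin n) Γ(Z, i ⁻¹ᵁ (V : X.Opens))
      Γ((Scheme.Modules.pullback i).obj (idealModule i), i ⁻¹ᵁ (V : X.Opens))) := by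
  classical
  haveI : IsLocallyNoetherian Z := LocallyOfFiniteType.isLocallyNoetherian i
  have hV : IsAffineOpen (V : X.Opens) := V.2
  have hU : IsAffineOpen (i ⁻¹ᵁ (V : X.Opens)) := hV.preimage i
  have le : i ⁻¹ᵁ (V : X.Opens) ≤ i ⁻¹ᵁ (V : X.Opens) := le_rfl
  set M : X.Modules := idealModule i with hMdef
  have hM : IsAffineLocalizing M := (coh_idealModule i).loc
  set φ : Γ(X, (V : X.Opens)) →+* Γ(Z, i ⁻¹ᵁ (V : X.Opens)) := (i.app (V : X.Opens)).hom with hφ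
  have hφsurj : Function.Surjective φ := i.app_surjective (V : X.Opens) hV
  have hker : i.ker.ideal V = RingHom.ker φ := Scheme.Hom.ker_apply i V
  have happLE : ∀ r, i.appLE (V : X.Opens) (i ⁻¹ᵁ (V : X.Opens)) le r = φ r := fun r ↦ by
    rw [Scheme.Hom.appLE_eq_app]
  let ρ : Γ(M, (V : X.Opens)) → Γ(X, (V : X.Opens)) := toRing (idealModuleι i) (V : X.Opens)
  have hρinj : Function.Injective ρ := kernel_ι_app_injective (structureModuleMap i) (V : X.Opens)
  have hρsum : ∀ (a : Fin n → Γ(X, (V : X.Opens))) (t : Fin n → Γ(M, (V : X.Opens))),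
      ρ (∑ j, a j • t j) = ∑ j, a j * ρ (t j) := by
    intro a t
    change ((idealModuleι i).app (V : X.Opens)).hom (∑ j, a j • t j) = _
    rw [map_sum]
    exact Finset.sum_congr rfl fun j _ ↦ toRing_smul (idealModuleι i) (V : X.Opens) (a j) (t j)
  have hx0 : ∀ j, (structureModuleMap i).app (V : X.Opens) (x j) = 0 := by
    intro j
    have hj : x j ∈ RingHom.ker φ := by
      rw [← hker, ← hI]
      exact Ideal.subset_span ⟨j, rfl⟩
    exact hj
  choose s hs using fun j ↦ exists_kernel_ι_app_eq (structureModuleMap i) (V : X.Opens) (x j) (hx0 j)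
  have hρs : ∀ j, ρ (s j) = x j := hs
  have hgen : ∀ m : Γ(M, (V : X.Opens)), ∃ a : Fin n → Γ(X, (V : X.Opens)), m = ∑ j, a j • s j := by
    intro m
    have hm : ρ m ∈ Ideal.span (Set.range x) := by
      rw [hI, hker]
      exact app_idealModuleι_eq_zero i (V : X.Opens) m
    obtain ⟨a, ha⟩ := Ideal.mem_span_range_iff_exists_fun.1 hm
    refine ⟨a, hρinj ?_⟩
    rw [hρsum, ← ha]
    exact Finset.sum_congr rfl fun j _ ↦ by rw [hρs]
  let b : Fin n → Γ((Scheme.Modules.pullback i).obj M, i ⁻¹ᵁ (V : X.Opens)) :=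
    fun j ↦ unitSectionLE i M le (s j)
  let η : Γ(M, (V : X.Opens)) →+ Γ((Scheme.Modules.pullback i).obj M, i ⁻¹ᵁ (V : X.Opens)) :=
    { toFun := unitSectionLE i M le
      map_zero' := by
        have h := unitSectionLE_add i M le (0 : Γ(M, (V : X.Opens))) 0
        rw [add_zero] at h
        exact left_eq_add.mp h
      map_add' := unitSectionLE_add i M le }
  have hηsum : ∀ a : Fin n → Γ(X, (V : X.Opens)),
      unitSectionLE i M le (∑ j, a j • s j) = ∑ j, φ (a j) • b j := by
    intro a
    change η (∑ j, a j • s j) = _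
    rw [map_sum]
    refine Finset.sum_congr rfl fun j _ ↦ ?_
    change unitSectionLE i M le (a j • s j) = _
    rw [unitSectionLE_smul, happLE]
  have hchart : (chartHom i le).hom = φ := by
    change (i.appLE (V : X.Opens) (i ⁻¹ᵁ (V : X.Opens)) le).hom = (i.app (V : X.Opens)).hom
    rw [Scheme.Hom.appLE_eq_app]
  have hφ'surj : Function.Surjective (chartHom i le).hom := by
    rw [hchart]
    exact hφsurj
  let q := appTopRestrictFromSpecEquiv M hV
  have hvanish : ∀ m : Γ(M, (V : X.Opens)), unitSectionLE i M le m = 0 →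
      ∃ d : Fin n → Γ(X, (V : X.Opens)), (∀ j, d j ∈ Ideal.span (Set.range x)) ∧ ∑ j, d j • s j = m := by
    intro m hm0
    have h2 : ((1 : Γ(Z, i ⁻¹ᵁ (V : X.Opens))) ⊗ₜ[Γ(X, (V : X.Opens)), (chartHom i le).hom] (q m) :
        chartTensor i M hV le) = 0 := by
      apply (chartSectionsEquiv i M hV hU le hM).injective
      rw [chartSectionsEquiv_one_tmul, hm0]
      exact (map_zero _).symm
    have h3 := mem_ker_smul_top_of_one_tmul_eq_zero_copy (chartHom i le).hom hφ'surj (restrictTop M hV) (q m) h2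
    have key : ∀ y ∈ RingHom.ker (chartHom i le).hom • (⊤ : Submodule Γ(X, (V : X.Opens)) (restrictTop M hV)),
        ∃ d : Fin n → Γ(X, (V : X.Opens)), (∀ j, d j ∈ Ideal.span (Set.range x)) ∧
          ∑ j, d j • s j = q.symm y := by
      intro y hy
      refine Submodule.smul_induction_on
        (p := fun y : restrictTop M hV ↦ ∃ d : Fin n → Γ(X, (V : X.Opens)),
          (∀ j, d j ∈ Ideal.span (Set.range x)) ∧ ∑ j, d j • s j = q.symm y) hy ?_ ?_
      · intro r hr y _
        obtain ⟨a', ha'⟩ := hgen (q.symm y)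
        have hr' : r ∈ Ideal.span (Set.range x) := by
          rw [hI, hker, ← hchart]
          exact hr
        refine ⟨fun j ↦ r * a' j, fun j ↦ Ideal.mul_mem_right _ _ hr', ?_⟩
        have hq : q.symm (r • y) = r • q.symm y := map_smul q.symm r y
        calc ∑ j, (r * a' j) • s j = r • ∑ j, a' j • s j := by
              rw [Finset.smul_sum]
              exact Finset.sum_congr rfl fun j _ ↦ by rw [mul_smul]
          _ = r • q.symm y := by rw [← ha']
          _ = q.symm (r • y) := hq.symm
      · rintro y z ⟨d, hd, hdy⟩ ⟨d', hd', hdz⟩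
        refine ⟨d + d', fun j ↦ Ideal.add_mem _ (hd j) (hd' j), ?_⟩
        calc ∑ j, (d + d') j • s j = ∑ j, d j • s j + ∑ j, d' j • s j := by
              rw [← Finset.sum_add_distrib]
              exact Finset.sum_congr rfl fun j _ ↦ by simp [add_smul]
          _ = q.symm y + q.symm z := by rw [hdy, hdz]
          _ = q.symm (y + z) := (map_add q.symm y z).symm
    obtain ⟨d, hd, hdm⟩ := key _ h3
    exact ⟨d, hd, by rw [hdm, LinearEquiv.symm_apply_apply]⟩
  have hli : LinearIndependent Γ(Z, i ⁻¹ᵁ (V : X.Opens)) b := by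
    rw [Fintype.linearIndependent_iff]
    intro c hc j
    choose a ha using fun j ↦ hφsurj (c j)
    have h1 : unitSectionLE i M le (∑ j, a j • s j) = 0 := by
      rw [hηsum, ← hc]
      exact Finset.sum_congr rfl fun j _ ↦ by rw [ha]
    obtain ⟨d, hd, hdsum⟩ := hvanish _ h1
    have hrel : ∑ k, (a k - d k) * x k = 0 := by
      have h := congrArg ρ hdsum
      rw [hρsum, hρsum] at h
      simp only [hρs] at h
      simp only [sub_mul, Finset.sum_sub_distrib, h, sub_self]
    have haj : a j ∈ Ideal.span (Set.range x) := by
      have h := Ideal.add_mem _ (hlech _ hrel j) (hd j)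
      rwa [sub_add_cancel] at h
    rw [hI, hker] at haj
    rw [← ha j]
    exact haj
  have hsp : ⊤ ≤ Submodule.span Γ(Z, i ⁻¹ᵁ (V : X.Opens)) (Set.range b) := by
    rintro y -
    obtain ⟨t, rfl⟩ := (chartSectionsEquiv i M hV hU le hM).surjective y
    induction t using TensorProduct.induction_on with
    | zero =>
      exact memSubmodule_of_eq_of_mem (AddEquiv.map_zero (chartSectionsEquiv i M hV hU le hM))
        (Submodule.zero_mem _)
    | tmul c q' =>
      obtain ⟨m, rfl⟩ := q.surjective q'
      obtain ⟨a, rfl⟩ := hgen m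
      have e2 : chartSectionsEquiv i M hV hU le hM
          ((show (ModuleCat.restrictScalars (chartHom i le).hom).obj
              (ModuleCat.of _ Γ(Z, i ⁻¹ᵁ (V : X.Opens))) from (1 : Γ(Z, i ⁻¹ᵁ (V : X.Opens))))
              ⊗ₜ[Γ(X, (V : X.Opens))]
            (q (∑ j, a j • s j) : restrictTop M hV)) = unitSectionLE i M le (∑ j, a j • s j) :=
        chartSectionsEquiv_one_tmul i M hV hU le hM (∑ j, a j • s j)
      have hc1 := ModuleCat.ExtendScalars.smul_tmul (chartHom i le).hom (M := restrictTop M hV)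
        (show Γ(Z, i ⁻¹ᵁ (V : X.Opens)) from c) 1 (q (∑ j, a j • s j) : restrictTop M hV)
      rw [mul_one] at hc1
      have e1 := chartSectionsEquiv_smul i M hV hU le hM (show Γ(Z, i ⁻¹ᵁ (V : X.Opens)) from c)
        ((show (ModuleCat.restrictScalars (chartHom i le).hom).obj
              (ModuleCat.of _ Γ(Z, i ⁻¹ᵁ (V : X.Opens))) from (1 : Γ(Z, i ⁻¹ᵁ (V : X.Opens))))
              ⊗ₜ[Γ(X, (V : X.Opens))]
            (q (∑ j, a j • s j) : restrictTop M hV))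
      have hval : chartSectionsEquiv i M hV hU le hM
          (c ⊗ₜ[Γ(X, (V : X.Opens))] (q (∑ j, a j • s j) : restrictTop M hV)) =
          (show Γ(Z, i ⁻¹ᵁ (V : X.Opens)) from c) • ∑ j, φ (a j) • b j := by
        rw [← hηsum, ← e2, ← e1]
        exact congrArg _ hc1.symm
      refine memSubmodule_of_eq_of_mem hval (Submodule.smul_mem _ _ (Submodule.sum_mem _ fun j _ ↦ ?_))
      exact Submodule.smul_mem _ _ (Submodule.subset_span ⟨j, rfl⟩)
    | add t₁ t₂ h₁ h₂ =>
      exact memSubmodule_of_eq_of_mem (AddEquiv.map_add (chartSectionsEquiv i M hV hU le hM) t₁ t₂)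
        (Submodule.add_mem _ h₁ h₂)
  exact ⟨Module.Basis.mk hli hsp⟩

set_option maxRecDepth 4000 in -- the change-of-rings instance chain of the affine chart is deep (as in the parent file)
/-- **Lech-independence twin of `HodgeTheory.exists_basis_sections_pullback_idealModule_eq`** (basis WITH its sections; proof
body verbatim from the Literature file, calling the twin above). [cite: GortzWedhorn2023, Rem. 19.22] -/
theorem exists_basis_sections_pullback_idealModule_eq_of_lech {X Z : Scheme.{u}} (i : Z ⟶ X)
    [IsLocallyNoetherian X] [IsClosedImmersion i]
    (V : X.affineOpens) {n : ℕ} (x : Fin n → Γ(X, (V : X.Opens)))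
    (hlech : ∀ c : Fin n → Γ(X, (V : X.Opens)), ∑ j, c j * x j = 0 → ∀ j, c j ∈ Ideal.span (Set.range x))
    (hI : Ideal.span (Set.range x) = i.ker.ideal V) :
    ∃ (s : Fin n → Γ(idealModule i, (V : X.Opens)))
      (b : Module.Basis (Fin n) Γ(Z, i ⁻¹ᵁ (V : X.Opens))
        Γ((Scheme.Modules.pullback i).obj (idealModule i), i ⁻¹ᵁ (V : X.Opens))),
      (∀ j, toRing (idealModuleι i) (V : X.Opens) (s j) = x j) ∧
      ∀ j, b j = unitSectionLE i (idealModule i) (le_refl (i ⁻¹ᵁ (V : X.Opens))) (s j) := by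
  classical
  haveI : IsLocallyNoetherian Z := LocallyOfFiniteType.isLocallyNoetherian i
  have hV : IsAffineOpen (V : X.Opens) := V.2
  have hU : IsAffineOpen (i ⁻¹ᵁ (V : X.Opens)) := hV.preimage i
  have le : i ⁻¹ᵁ (V : X.Opens) ≤ i ⁻¹ᵁ (V : X.Opens) := le_rfl
  set M : X.Modules := idealModule i with hMdef
  have hM : IsAffineLocalizing M := (coh_idealModule i).loc
  set φ : Γ(X, (V : X.Opens)) →+* Γ(Z, i ⁻¹ᵁ (V : X.Opens)) := (i.app (V : X.Opens)).hom with hφ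
  have hφsurj : Function.Surjective φ := i.app_surjective (V : X.Opens) hV
  have hker : i.ker.ideal V = RingHom.ker φ := Scheme.Hom.ker_apply i V
  have happLE : ∀ r, i.appLE (V : X.Opens) (i ⁻¹ᵁ (V : X.Opens)) le r = φ r := fun r ↦ by
    rw [Scheme.Hom.appLE_eq_app]
  let ρ : Γ(M, (V : X.Opens)) → Γ(X, (V : X.Opens)) := toRing (idealModuleι i) (V : X.Opens)
  have hρinj : Function.Injective ρ := kernel_ι_app_injective (structureModuleMap i) (V : X.Opens)
  have hρsum : ∀ (a : Fin n → Γ(X, (V : X.Opens))) (t : Fin n → Γ(M, (V : X.Opens))),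
      ρ (∑ j, a j • t j) = ∑ j, a j * ρ (t j) := by
    intro a t
    change ((idealModuleι i).app (V : X.Opens)).hom (∑ j, a j • t j) = _
    rw [map_sum]
    exact Finset.sum_congr rfl fun j _ ↦ toRing_smul (idealModuleι i) (V : X.Opens) (a j) (t j)
  have hx0 : ∀ j, (structureModuleMap i).app (V : X.Opens) (x j) = 0 := by
    intro j
    have hj : x j ∈ RingHom.ker φ := by
      rw [← hker, ← hI]
      exact Ideal.subset_span ⟨j, rfl⟩
    exact hj
  choose s hs using fun j ↦ exists_kernel_ι_app_eq (structureModuleMap i) (V : X.Opens) (x j) (hx0 j)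
  have hρs : ∀ j, ρ (s j) = x j := hs
  have hgen : ∀ m : Γ(M, (V : X.Opens)), ∃ a : Fin n → Γ(X, (V : X.Opens)), m = ∑ j, a j • s j := by
    intro m
    have hm : ρ m ∈ Ideal.span (Set.range x) := by
      rw [hI, hker]
      exact app_idealModuleι_eq_zero i (V : X.Opens) m
    obtain ⟨a, ha⟩ := Ideal.mem_span_range_iff_exists_fun.1 hm
    refine ⟨a, hρinj ?_⟩
    rw [hρsum, ← ha]
    exact Finset.sum_congr rfl fun j _ ↦ by rw [hρs]
  let b : Fin n → Γ((Scheme.Modules.pullback i).obj M, i ⁻¹ᵁ (V : X.Opens)) :=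
    fun j ↦ unitSectionLE i M le (s j)
  let η : Γ(M, (V : X.Opens)) →+ Γ((Scheme.Modules.pullback i).obj M, i ⁻¹ᵁ (V : X.Opens)) :=
    { toFun := unitSectionLE i M le
      map_zero' := by
        have h := unitSectionLE_add i M le (0 : Γ(M, (V : X.Opens))) 0
        rw [add_zero] at h
        exact left_eq_add.mp h
      map_add' := unitSectionLE_add i M le }
  have hηsum : ∀ a : Fin n → Γ(X, (V : X.Opens)),
      unitSectionLE i M le (∑ j, a j • s j) = ∑ j, φ (a j) • b j := by
    intro a
    change η (∑ j, a j • s j) = _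
    rw [map_sum]
    refine Finset.sum_congr rfl fun j _ ↦ ?_
    change unitSectionLE i M le (a j • s j) = _
    rw [unitSectionLE_smul, happLE]
  let q := appTopRestrictFromSpecEquiv M hV
  have hsp : ⊤ ≤ Submodule.span Γ(Z, i ⁻¹ᵁ (V : X.Opens)) (Set.range b) := by
    rintro y -
    obtain ⟨t, rfl⟩ := (chartSectionsEquiv i M hV hU le hM).surjective y
    induction t using TensorProduct.induction_on with
    | zero =>
      exact memSubmodule_of_eq_of_mem (AddEquiv.map_zero (chartSectionsEquiv i M hV hU le hM))
        (Submodule.zero_mem _)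
    | tmul c q' =>
      obtain ⟨m, rfl⟩ := q.surjective q'
      obtain ⟨a, rfl⟩ := hgen m
      have e2 : chartSectionsEquiv i M hV hU le hM
          ((show (ModuleCat.restrictScalars (chartHom i le).hom).obj
              (ModuleCat.of _ Γ(Z, i ⁻¹ᵁ (V : X.Opens))) from (1 : Γ(Z, i ⁻¹ᵁ (V : X.Opens))))
              ⊗ₜ[Γ(X, (V : X.Opens))]
            (q (∑ j, a j • s j) : restrictTop M hV)) = unitSectionLE i M le (∑ j, a j • s j) :=
        chartSectionsEquiv_one_tmul i M hV hU le hM (∑ j, a j • s j)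
      have hc1 := ModuleCat.ExtendScalars.smul_tmul (chartHom i le).hom (M := restrictTop M hV)
        (show Γ(Z, i ⁻¹ᵁ (V : X.Opens)) from c) 1 (q (∑ j, a j • s j) : restrictTop M hV)
      rw [mul_one] at hc1
      have e1 := chartSectionsEquiv_smul i M hV hU le hM (show Γ(Z, i ⁻¹ᵁ (V : X.Opens)) from c)
        ((show (ModuleCat.restrictScalars (chartHom i le).hom).obj
              (ModuleCat.of _ Γ(Z, i ⁻¹ᵁ (V : X.Opens))) from (1 : Γ(Z, i ⁻¹ᵁ (V : X.Opens))))
              ⊗ₜ[Γ(X, (V : X.Opens))]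
            (q (∑ j, a j • s j) : restrictTop M hV))
      have hval : chartSectionsEquiv i M hV hU le hM
          (c ⊗ₜ[Γ(X, (V : X.Opens))] (q (∑ j, a j • s j) : restrictTop M hV)) =
          (show Γ(Z, i ⁻¹ᵁ (V : X.Opens)) from c) • ∑ j, φ (a j) • b j := by
        rw [← hηsum, ← e2, ← e1]
        exact congrArg _ hc1.symm
      refine memSubmodule_of_eq_of_mem hval (Submodule.smul_mem _ _ (Submodule.sum_mem _ fun j _ ↦ ?_))
      exact Submodule.smul_mem _ _ (Submodule.subset_span ⟨j, rfl⟩)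
    | add t₁ t₂ h₁ h₂ =>
      exact memSubmodule_of_eq_of_mem (AddEquiv.map_add (chartSectionsEquiv i M hV hU le hM) t₁ t₂)
        (Submodule.add_mem _ h₁ h₂)
  obtain ⟨b₀⟩ := nonempty_basis_sections_pullback_idealModule_of_lech i V x hlech hI
  have hli : LinearIndependent Γ(Z, i ⁻¹ᵁ (V : X.Opens)) b := by
    rw [linearIndependent_iff_injective_fintypeLinearCombination]
    set f := Fintype.linearCombination Γ(Z, i ⁻¹ᵁ (V : X.Opens)) b with hf
    have hfsurj : Function.Surjective f := by
      rw [← LinearMap.range_eq_top, hf, Fintype.range_linearCombination]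
      exact top_le_iff.mp hsp
    have hE : Function.Injective (b₀.equivFun.toLinearMap ∘ₗ f) :=
      OrzechProperty.injective_of_surjective_endomorphism _ (b₀.equivFun.surjective.comp hfsurj)
    exact fun c c' h => hE (by change b₀.equivFun (f c) = b₀.equivFun (f c'); rw [h])
  refine ⟨s, Module.Basis.mk hli hsp, hρs, fun j => ?_⟩
  rw [Module.Basis.mk_apply]

/-- **B1′⁺ — conormal frame from a QUASI-REGULAR generating sequence** (twin of res-rescue-typ-5's
`exists_conormalFrame_of_generators` p586543 with `IsWeaklyRegular` replaced by `IsQuasiRegular`): on an affine `V` with `x`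
quasi-regular generating the ideal of the closed immersion `i`, sections `s_j ∈ Γ(V, 𝓘)` reading to `x_j` and a frame
`𝒪^n ≅ 𝒞_i|_{i⁻¹V}` with basis sections `η(s_j)`. [OURS · L1 W4.5b · S6 (L) C2 B1′⁺] -/
theorem exists_conormalFrame_of_generators_of_isQuasiRegular {X Z : Scheme.{0}} (i : Z ⟶ X) [IsClosedImmersion i]
    [IsLocallyNoetherian X] (V : X.affineOpens) {n : ℕ} (x : Fin n → Γ(X, (V : X.Opens))) (hqr : IsQuasiRegular x)
    (hI : Ideal.span (Set.range x) = i.ker.ideal V) :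
    ∃ (s : Fin n → Γ(idealModule i, (V : X.Opens))) (e : SheafOfModules.free (Fin n) ≅ (conormalSheaf i).over (i ⁻¹ᵁ (V : X.Opens))),
      (∀ j, toRing (idealModuleι i) (V : X.Opens) (s j) = x j) ∧
      ∀ j, basisSection e j = unitSectionLE i (idealModule i) (le_refl _) (s j) := by
  obtain ⟨s, b, hs, hb⟩ := exists_basis_sections_pullback_idealModule_eq_of_lech i V x (fun c hc j => IsQuasiRegular.lech hqr c hc j) hI
  obtain ⟨e₀⟩ := nonempty_free_iso_over_of_basis (conormalSheaf i) (coh_conormalSheaf i).loc (V.2.preimage i) b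
  obtain ⟨e, he⟩ := exists_frame_of_basis e₀ b
  exact ⟨s, e, hs, fun j => (he j).trans (hb j)⟩

end Summit.ResolutionOfSingularities.ResolutionOfSingularities.Cruxes.EquisingularLiftNat.Sections

end
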